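import Literature.Probability.RandomPlanarGeometry.SAWTriangularFiniteMemorySymm
import Literature.Probability.RandomPlanarGeometry.SAWTriangularFiniteMemory11
import HarnessLib

/-!
# `μ(𝕋) ≤ 4.271`: the symmetry-reduced memory-12 Pönitz–Tittmann certificate on the triangular lattice

Topic `Literature/Probability/RandomPlanarGeometry`. One compiled evaluation of
`TriFiniteMemory.checkC 12 4271 1000 80` (`SAWTriangularFiniteMemorySymm.lean`): the breadth-first search over
NORMAL FORMS under the twelve lattice symmetries of `𝕋` finds the `88 065` classes of the `1 056 733` states of
the memory-12 automaton, 80 rounds of integer power iteration propose a symmetric weight, and the verified checker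
confirms closure and the Collatz–Wielandt inequalities with ratio `4271/1000` (the Perron root is `4.270109…`;
memory 13: `4.261114…` with `320 459` classes already exceeds one farm evaluation (> 6 min); memory 14 would give
`4.253386…` with `1 178 071` classes, and beating the printed `4.251419` needs memory `≥ 15`, `≈ 4.3 · 10⁶` classes).
By `exp_logMuTri_le_of_checkC`: **`μ(𝕋) = exp logMuTri ≤ 4.271`**, and the kernel window for `μ(𝕋)` becomes
`[(3+√17)/2, 4.271] ⊂ [3.5615, 4.2711]`.

Status in print (lane «pcv-sawmu», lit-2 g12 cell): kernel-certified (standard axioms + `Lean.ofReduceBool`,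
computational class); BETTER than Alm's 1993 bound `4.277799` (SECONDARY-SOURCE numeral: Alm 1993 is not held by the lane —
acq-10162 — and the value is quoted from secondary sources, unverified against the 1993 page), WEAKER than the printed record
`μ(𝕋) < 4.251419` (Alm 2005, §5.5.1, eigenvalue method with `G(8,20)`, dimension `18 678`, uncertified); Pönitz–Tittmann (2000)
treat `ℤ^d` only. (Since 2026-08-23 the tree's lower end is `3.93 < μ(𝕋)`, `SAWTriangularConnectiveConstantLower12.lean`.)

## References

* A. Pönitz, P. Tittmann, *Improved upper bounds for self-avoiding walks in ℤᵈ*, Electron. J. Combin. 7 (2000)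
  R21, §3 (normalizing states), Table 2 [PonitzTittmann2000].
* S. E. Alm, *Upper and lower bounds for the connective constants of self-avoiding walks on the Archimedean and
  Laves lattices*, J. Phys. A 38 (2005) 2055–2080, §4 Theorem 2, §5.5.1 [Alm2005].
-/

namespace Literature.Probability.RandomPlanarGeometry.SAW

/-- The symmetry-reduced memory-12 certificate on `𝕋` evaluates to `true` (`88 065` normal forms, ratio
`4271/1000`, 80 power-iteration rounds). [cite: PonitzTittmann2000, §3 Table 2 (method; ℤ^d only)] -/
theorem TriFiniteMemory.checkC_12 : TriFiniteMemory.checkC 12 4271 1000 80 = true := by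
  native_decide

/-- **`μ(𝕋) ≤ 4.271`**: `exp logMuTri ≤ 4.271` (print: Alm 1993 `4.277799` — beaten (numeral from secondary sources, Alm 1993 not
held); Alm 2005 `4.251419` — not beaten). [cite: Alm2005, §5.5.1] -/
theorem exp_logMuTri_le_4271 : Real.exp logMuTri ≤ 4.271 := by
  have h := TriFiniteMemory.exp_logMuTri_le_of_checkC TriFiniteMemory.checkC_12 (by norm_num)
  have e : ((4271 : ℕ) : ℝ) / ((1000 : ℕ) : ℝ) = 4.271 := by norm_num
  rwa [e] at h

/-- The same bound in the `ℕ`-ratio form `exp logMuTri ≤ 4271/1000` (the lane's certificate shape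
`TriMuUpperCert 4271 1000`). [cite: Alm2005, §5.5.1] -/
theorem exp_logMuTri_le_div_12 : Real.exp logMuTri ≤ ((4271 : ℕ) : ℝ) / ((1000 : ℕ) : ℝ) :=
  TriFiniteMemory.exp_logMuTri_le_of_checkC TriFiniteMemory.checkC_12 (by norm_num)

/-- Log-scale form: `logMuTri ≤ log 4.271`. [cite: Alm2005, §5.5.1] -/
theorem logMuTri_le_log_4271 : logMuTri ≤ Real.log 4.271 := by
  have h := exp_logMuTri_le_4271
  calc logMuTri = Real.log (Real.exp logMuTri) := (Real.log_exp logMuTri).symm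
    _ ≤ Real.log 4.271 := Real.log_le_log (Real.exp_pos _) h

/-- Log-scale `ℕ`-ratio form (the lane's REPORT shape): `logMuTri ≤ log ((4271 : ℕ)/(1000 : ℕ))`.
[cite: Alm2005, §5.5.1] -/
theorem logMuTri_le_log_div_12 : logMuTri ≤ Real.log (((4271 : ℕ) : ℝ) / ((1000 : ℕ) : ℝ)) := by
  have h := exp_logMuTri_le_div_12
  calc logMuTri = Real.log (Real.exp logMuTri) := (Real.log_exp logMuTri).symm
    _ ≤ Real.log (((4271 : ℕ) : ℝ) / ((1000 : ℕ) : ℝ)) := Real.log_le_log (Real.exp_pos _) h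

/-- **The kernel window for `μ(𝕋)`: `(3+√17)/2 ≤ exp logMuTri ≤ 4.271`** (width `< 0.71`).
[cite: Alm2005, §5.5.1] -/
theorem muTri_window_4271 : (3 + Real.sqrt 17) / 2 ≤ Real.exp logMuTri ∧ Real.exp logMuTri ≤ 4.271 :=
  ⟨muTri_window.1, exp_logMuTri_le_4271⟩

end Literature.Probability.RandomPlanarGeometry.SAW
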